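import Summits.AtomisticToContinuum.Crystallization.Theorems.FreeSplittingCertificatesStrictSplittingRuleP1CellSum
import Summits.AtomisticToContinuum.Crystallization.Theorems.FreeSplittingCertificatesStrictSplittingRuleFarTransferOctUpReceipts
import Summits.AtomisticToContinuum.Crystallization.Theorems.FreeSplittingCertificatesStrictSplittingRuleFarTransferOctDownReceipts
import Summits.AtomisticToContinuum.Crystallization.Theorems.PalmUnimodularRigidityLayeredLawsSelectHcpReRoot

/-!
# `StrictSplittingRule` (stmt-AtomisticToContinuum-12560): the OCTAHEDRON receipts lemmas APPLIED to the P1 interpolant — per cube, the four quarter gradients are paid by the twelve edge stretches (P1 interpolant object, part 11)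

Route `FreeSplittingCertificates`, crux r3 `StrictSplittingRule` (H12⋆ = `stub_coreJointCoercive`), unit b2b-freesplit-B gen 20.
VALUE = the element algebra of the transfer (gen 13: `hcpOctUp_receipts`, `hcpOctDown_receipts`) INSTANTIATED on the interpolant object (parts 1–10):
for the far-ledger field `v = p1Disp a h U b₀ A` and every cube `n` of the chart, the receipts forms of the four octahedron quarters `(n,2),…,(n,5)`
(constant gradients `p1CellGrad − A`, transposed to the element lemmas' index convention: `p1CellGradT`) satisfy
`min(a⁴,a²h²,h⁴)·Σ_{π=2..5} fpRec(G_{(n,π)}) ≤ 504·Σ_{12 edges e} ⟪y_e, v(head e) − v(tail e)⟫²` — even cubes via `hcpOctUp_receipts` (`p1OctUp_receipts`),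
odd cubes via `hcpOctDown_receipts` (`p1OctDown_receipts`); the twelve hypotheses of those lemmas are discharged by `p1CellGrad_vertex_sub` + `hcpSite_add_of_even`.
Item (2') of HOME FAR-LEMMA-SPEC §16 (c) (receipts side), octahedra.  NOT a proof of H12⋆, NOT summit progress.  [folklore]
-/

noncomputable section

open Set Function

namespace Summit.AtomisticToContinuum.Crystallization.Theorems.StrictSplittingRuleBirth

open Literature.MathematicalPhysics.StatisticalMechanics
open Summit.AtomisticToContinuum.Crystallization.Theorems.PalmUnimodularRigidity.LayeredLawsSelectHcp
open Summit.AtomisticToContinuum.Crystallization.Theorems.PhononStabilityCWC.Cert (inner_fin3)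

/-! ## Values at sites and the transposed cell gradient -/

/-- The far-ledger field at the site `n'`, as a Euclidean vector (the `w_j` of the element lemmas). -/
def p1DispSite (a h : ℝ) (U : ℤ × ℤ × ℤ → (Fin 3 → ℝ)) (b₀ : Fin 3 → ℝ) (A : Fin 3 → Fin 3 → ℝ) (n' : ℤ × ℤ × ℤ) :
    EuclideanSpace ℝ (Fin 3) :=
  WithLp.toLp 2 (p1Disp a h U b₀ A (fun j => hcpSite a h n' j))

/-- The cell gradient of the far-ledger field in the element lemmas' index convention (component first): `(G − A)ᵀ`. -/
def p1CellGradT (a h : ℝ) (U : ℤ × ℤ × ℤ → (Fin 3 → ℝ)) (A : Fin 3 → Fin 3 → ℝ) (i : (ℤ × ℤ × ℤ) × Fin 6) : Fin 3 → Fin 3 → ℝ :=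
  fun k j => p1CellGrad a h U i j k - A j k

/-- `fpRec` is invariant under transposition (only `tr` and the symmetric part enter). -/
theorem fpRec_transpose (G : Fin 3 → Fin 3 → ℝ) : fpRec (fun i j => G j i) = fpRec G := by
  simp only [fpRec, fpTr, fpSymSq]
  ring

/-- The transposed cell gradient has the same receipts form as `p1CellGrad − A`. -/
theorem fpRec_p1CellGradT (a h : ℝ) (U : ℤ × ℤ × ℤ → (Fin 3 → ℝ)) (A : Fin 3 → Fin 3 → ℝ) (i : (ℤ × ℤ × ℤ) × Fin 6) :
    fpRec (p1CellGradT a h U A i) = fpRec (fun j k => p1CellGrad a h U i j k - A j k) :=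
  fpRec_transpose _

/-- The value at a site is `U − b₀ − A·y` there. -/
theorem p1DispSite_apply {a h : ℝ} (ha : a ≠ 0) (hh : h ≠ 0) (U : ℤ × ℤ × ℤ → (Fin 3 → ℝ)) (b₀ : Fin 3 → ℝ)
    (A : Fin 3 → Fin 3 → ℝ) (n' : ℤ × ℤ × ℤ) (k : Fin 3) :
    p1DispSite a h U b₀ A n' k = U n' k - (b₀ k + (hcpSite a h n' 0 * A 0 k + hcpSite a h n' 1 * A 1 k + hcpSite a h n' 2 * A 2 k)) := by
  rw [p1DispSite, PiLp.toLp_apply, p1Disp, Pi.sub_apply, p1Field_hcpSite ha hh, Pi.add_apply, p1AffCLM_apply]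

/-- **The hypothesis shape of the element lemmas**: for two vertices `v = n + v_m`, `w = n + v_{m'}` of the cell `i` with `y_v − y_w = y_d`,
`(w_v − w_w)_k = Σ_j Gᵀ_{kj} (y_d)_j`. -/
theorem p1DispSite_vertex_sub {a h : ℝ} (ha : a ≠ 0) (hh : h ≠ 0) (U : ℤ × ℤ × ℤ → (Fin 3 → ℝ)) (b₀ : Fin 3 → ℝ)
    (A : Fin 3 → Fin 3 → ℝ) (i : (ℤ × ℤ × ℤ) × Fin 6) {m m' : Fin 4} {v w d : ℤ × ℤ × ℤ}
    (hv : v = i.1 + p1VertOff (p1Par i.1) i.2 m) (hw : w = i.1 + p1VertOff (p1Par i.1) i.2 m')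
    (hd : ∀ k, hcpSite a h v k - hcpSite a h w k = hcpSite a h d k) :
    ∀ k, (p1DispSite a h U b₀ A v - p1DispSite a h U b₀ A w) k =
      p1CellGradT a h U A i k 0 * hcpSite a h d 0 + p1CellGradT a h U A i k 1 * hcpSite a h d 1 +
        p1CellGradT a h U A i k 2 * hcpSite a h d 2 := by
  intro k
  have hG := p1CellGrad_vertex_sub ha hh U i m m' k
  rw [← hv, ← hw, Pi.sub_apply] at hG
  rw [PiLp.sub_apply, p1DispSite_apply ha hh, p1DispSite_apply ha hh, ← hd 0, ← hd 1, ← hd 2]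
  simp only [p1CellGradT]
  linear_combination hG

/-- **Octahedron receipts for the interpolant, EVEN cube** `n` (`p1Par n = true`): the four quarter gradients `(n,2),…,(n,5)` of the far-ledger field are
paid by the twelve edge stretches of the octahedron `B₁ = n+(0, 0, 1), B₂ = n+(0, 1, 1), B₃ = n+(0, 1, 0), X₁ = n+(1, 0, 0), X₂ = n+(1, 1, 0), X₃ = n+(1, 0, 1)` —
`hcpOctUp_receipts` with its twelve hypotheses discharged.  NOT a proof of H12⋆, NOT summit progress. -/
theorem p1OctUp_receipts {a h : ℝ} (ha : a ≠ 0) (hh : h ≠ 0) (U : ℤ × ℤ × ℤ → (Fin 3 → ℝ)) (b₀ : Fin 3 → ℝ) (A : Fin 3 → Fin 3 → ℝ)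
    (n : ℤ × ℤ × ℤ) (hn : p1Par n = true) :
    min (min (a ^ 4) (a ^ 2 * h ^ 2)) (h ^ 4) *
        (fpRec (p1CellGradT a h U A (n, 2)) + fpRec (p1CellGradT a h U A (n, 3)) + fpRec (p1CellGradT a h U A (n, 4)) + fpRec (p1CellGradT a h U A (n, 5))) ≤
      504 * (inner ℝ (hcpSite a h (0, 1, 0)) (p1DispSite a h U b₀ A (n + (0, 1, 1)) - p1DispSite a h U b₀ A (n + (0, 0, 1))) ^ 2 +
        inner ℝ (hcpSite a h (0, 1, -1)) (p1DispSite a h U b₀ A (n + (0, 1, 0)) - p1DispSite a h U b₀ A (n + (0, 0, 1))) ^ 2 +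
        inner ℝ (hcpSite a h (1, 0, -1)) (p1DispSite a h U b₀ A (n + (1, 0, 0)) - p1DispSite a h U b₀ A (n + (0, 0, 1))) ^ 2 +
        inner ℝ (hcpSite a h (1, 0, 0)) (p1DispSite a h U b₀ A (n + (1, 0, 1)) - p1DispSite a h U b₀ A (n + (0, 0, 1))) ^ 2 +
        inner ℝ (hcpSite a h (1, 0, -1)) (p1DispSite a h U b₀ A (n + (1, 1, 0)) - p1DispSite a h U b₀ A (n + (0, 1, 1))) ^ 2 +
        inner ℝ (hcpSite a h (1, 0, 0)) (p1DispSite a h U b₀ A (n + (1, 1, 0)) - p1DispSite a h U b₀ A (n + (0, 1, 0))) ^ 2 +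
        inner ℝ (hcpSite a h (0, 1, 0)) (p1DispSite a h U b₀ A (n + (1, 1, 0)) - p1DispSite a h U b₀ A (n + (1, 0, 0))) ^ 2 +
        inner ℝ (hcpSite a h (0, 1, -1)) (p1DispSite a h U b₀ A (n + (1, 1, 0)) - p1DispSite a h U b₀ A (n + (1, 0, 1))) ^ 2 +
        inner ℝ (hcpSite a h (0, 0, -1)) (p1DispSite a h U b₀ A (n + (0, 1, 0)) - p1DispSite a h U b₀ A (n + (0, 1, 1))) ^ 2 +
        inner ℝ (hcpSite a h (1, -1, 0)) (p1DispSite a h U b₀ A (n + (1, 0, 1)) - p1DispSite a h U b₀ A (n + (0, 1, 1))) ^ 2 +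
        inner ℝ (hcpSite a h (1, -1, 0)) (p1DispSite a h U b₀ A (n + (1, 0, 0)) - p1DispSite a h U b₀ A (n + (0, 1, 0))) ^ 2 +
        inner ℝ (hcpSite a h (0, 0, 1)) (p1DispSite a h U b₀ A (n + (1, 0, 1)) - p1DispSite a h U b₀ A (n + (1, 0, 0))) ^ 2) := by
  have hB1 : Even (n + (0, 0, 1)).1 := by
    have hn' : decide (Even n.1) = true := hn
    show Even (n.1 + 0)
    simpa using (of_decide_eq_true hn' : Even n.1)
  -- edge vectors from B₁ are hcp-site labels (B₁ lies in an even layer)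
  have hd0 : ∀ k, hcpSite a h (n + (0, 1, 0)) k - hcpSite a h (n + (0, 0, 1)) k = hcpSite a h (0, 1, -1) k := by
    intro k
    have : ((n + (0, 1, 0)) : ℤ × ℤ × ℤ) = (n + (0, 0, 1)) + (0, 1, -1) := by ext <;> simp
    rw [this, hcpSite_add_of_even a h hB1, PiLp.add_apply]
    ring
  have hd1 : ∀ k, hcpSite a h (n + (0, 1, 1)) k - hcpSite a h (n + (0, 0, 1)) k = hcpSite a h (0, 1, 0) k := by
    intro k
    have : ((n + (0, 1, 1)) : ℤ × ℤ × ℤ) = (n + (0, 0, 1)) + (0, 1, 0) := by ext <;> simp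
    rw [this, hcpSite_add_of_even a h hB1, PiLp.add_apply]
    ring
  have hd2 : ∀ k, hcpSite a h (n + (1, 0, 0)) k - hcpSite a h (n + (0, 0, 1)) k = hcpSite a h (1, 0, -1) k := by
    intro k
    have : ((n + (1, 0, 0)) : ℤ × ℤ × ℤ) = (n + (0, 0, 1)) + (1, 0, -1) := by ext <;> simp
    rw [this, hcpSite_add_of_even a h hB1, PiLp.add_apply]
    ring
  have hd3 : ∀ k, hcpSite a h (n + (1, 0, 1)) k - hcpSite a h (n + (0, 0, 1)) k = hcpSite a h (1, 0, 0) k := by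
    intro k
    have : ((n + (1, 0, 1)) : ℤ × ℤ × ℤ) = (n + (0, 0, 1)) + (1, 0, 0) := by ext <;> simp
    rw [this, hcpSite_add_of_even a h hB1, PiLp.add_apply]
    ring
  have hd4 : ∀ k, hcpSite a h (n + (1, 1, 0)) k - hcpSite a h (n + (0, 0, 1)) k = hcpSite a h (1, 1, -1) k := by
    intro k
    have : ((n + (1, 1, 0)) : ℤ × ℤ × ℤ) = (n + (0, 0, 1)) + (1, 1, -1) := by ext <;> simp
    rw [this, hcpSite_add_of_even a h hB1, PiLp.add_apply]
    ring
  have h14 := p1DispSite_vertex_sub ha hh U b₀ A (n, 2) (m := 1) (m' := 0) (v := (n + (1, 1, 0))) (w := (n + (0, 0, 1)))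
    (by simp [hn, p1VertOff]) (by simp [hn, p1VertOff]) hd4
  have h11 := p1DispSite_vertex_sub ha hh U b₀ A (n, 2) (m := 2) (m' := 0) (v := (n + (0, 1, 1))) (w := (n + (0, 0, 1)))
    (by simp [hn, p1VertOff]) (by simp [hn, p1VertOff]) hd1
  have h12 := p1DispSite_vertex_sub ha hh U b₀ A (n, 2) (m := 3) (m' := 0) (v := (n + (0, 1, 0))) (w := (n + (0, 0, 1)))
    (by simp [hn, p1VertOff]) (by simp [hn, p1VertOff]) hd0
  have h24 := p1DispSite_vertex_sub ha hh U b₀ A (n, 3) (m := 1) (m' := 0) (v := (n + (1, 1, 0))) (w := (n + (0, 0, 1)))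
    (by simp [hn, p1VertOff]) (by simp [hn, p1VertOff]) hd4
  have h22 := p1DispSite_vertex_sub ha hh U b₀ A (n, 3) (m := 2) (m' := 0) (v := (n + (0, 1, 0))) (w := (n + (0, 0, 1)))
    (by simp [hn, p1VertOff]) (by simp [hn, p1VertOff]) hd0
  have h23 := p1DispSite_vertex_sub ha hh U b₀ A (n, 3) (m := 3) (m' := 0) (v := (n + (1, 0, 0))) (w := (n + (0, 0, 1)))
    (by simp [hn, p1VertOff]) (by simp [hn, p1VertOff]) hd2
  have h34 := p1DispSite_vertex_sub ha hh U b₀ A (n, 4) (m := 1) (m' := 0) (v := (n + (1, 1, 0))) (w := (n + (0, 0, 1)))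
    (by simp [hn, p1VertOff]) (by simp [hn, p1VertOff]) hd4
  have h33 := p1DispSite_vertex_sub ha hh U b₀ A (n, 4) (m := 2) (m' := 0) (v := (n + (1, 0, 0))) (w := (n + (0, 0, 1)))
    (by simp [hn, p1VertOff]) (by simp [hn, p1VertOff]) hd2
  have h35 := p1DispSite_vertex_sub ha hh U b₀ A (n, 4) (m := 3) (m' := 0) (v := (n + (1, 0, 1))) (w := (n + (0, 0, 1)))
    (by simp [hn, p1VertOff]) (by simp [hn, p1VertOff]) hd3
  have h44 := p1DispSite_vertex_sub ha hh U b₀ A (n, 5) (m := 1) (m' := 0) (v := (n + (1, 1, 0))) (w := (n + (0, 0, 1)))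
    (by simp [hn, p1VertOff]) (by simp [hn, p1VertOff]) hd4
  have h45 := p1DispSite_vertex_sub ha hh U b₀ A (n, 5) (m := 2) (m' := 0) (v := (n + (1, 0, 1))) (w := (n + (0, 0, 1)))
    (by simp [hn, p1VertOff]) (by simp [hn, p1VertOff]) hd3
  have h41 := p1DispSite_vertex_sub ha hh U b₀ A (n, 5) (m := 3) (m' := 0) (v := (n + (0, 1, 1))) (w := (n + (0, 0, 1)))
    (by simp [hn, p1VertOff]) (by simp [hn, p1VertOff]) hd1
  exact hcpOctUp_receipts a h (p1DispSite a h U b₀ A (n + (0, 0, 1))) (p1DispSite a h U b₀ A (n + (0, 1, 1))) (p1DispSite a h U b₀ A (n + (0, 1, 0))) (p1DispSite a h U b₀ A (n + (1, 0, 0))) (p1DispSite a h U b₀ A (n + (1, 1, 0))) (p1DispSite a h U b₀ A (n + (1, 0, 1)))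
    (p1CellGradT a h U A (n, 2)) (p1CellGradT a h U A (n, 3)) (p1CellGradT a h U A (n, 4)) (p1CellGradT a h U A (n, 5)) h14 h11 h12 h24 h22 h23 h34 h33 h35 h44 h45 h41

/-- **Octahedron receipts for the interpolant, ODD cube** `n` (`p1Par n = false`): the four quarter gradients `(n,2),…,(n,5)` of the far-ledger field are
paid by the twelve edge stretches of the octahedron `B₁ = n+(1, 0, 1), B₂ = n+(1, 1, 1), B₃ = n+(1, 1, 0), X₁ = n+(0, 0, 0), X₂ = n+(0, 1, 0), X₃ = n+(0, 0, 1)` —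
`hcpOctDown_receipts` with its twelve hypotheses discharged.  NOT a proof of H12⋆, NOT summit progress. -/
theorem p1OctDown_receipts {a h : ℝ} (ha : a ≠ 0) (hh : h ≠ 0) (U : ℤ × ℤ × ℤ → (Fin 3 → ℝ)) (b₀ : Fin 3 → ℝ) (A : Fin 3 → Fin 3 → ℝ)
    (n : ℤ × ℤ × ℤ) (hn : p1Par n = false) :
    min (min (a ^ 4) (a ^ 2 * h ^ 2)) (h ^ 4) *
        (fpRec (p1CellGradT a h U A (n, 2)) + fpRec (p1CellGradT a h U A (n, 3)) + fpRec (p1CellGradT a h U A (n, 4)) + fpRec (p1CellGradT a h U A (n, 5))) ≤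
      504 * (inner ℝ (hcpSite a h (0, 1, 0)) (p1DispSite a h U b₀ A (n + (1, 1, 1)) - p1DispSite a h U b₀ A (n + (1, 0, 1))) ^ 2 +
        inner ℝ (hcpSite a h (0, 1, -1)) (p1DispSite a h U b₀ A (n + (1, 1, 0)) - p1DispSite a h U b₀ A (n + (1, 0, 1))) ^ 2 +
        inner ℝ (hcpSite a h (-1, 0, -1)) (p1DispSite a h U b₀ A (n + (0, 0, 0)) - p1DispSite a h U b₀ A (n + (1, 0, 1))) ^ 2 +
        inner ℝ (hcpSite a h (-1, 0, 0)) (p1DispSite a h U b₀ A (n + (0, 0, 1)) - p1DispSite a h U b₀ A (n + (1, 0, 1))) ^ 2 +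
        inner ℝ (hcpSite a h (-1, 0, -1)) (p1DispSite a h U b₀ A (n + (0, 1, 0)) - p1DispSite a h U b₀ A (n + (1, 1, 1))) ^ 2 +
        inner ℝ (hcpSite a h (-1, 0, 0)) (p1DispSite a h U b₀ A (n + (0, 1, 0)) - p1DispSite a h U b₀ A (n + (1, 1, 0))) ^ 2 +
        inner ℝ (hcpSite a h (0, 1, 0)) (p1DispSite a h U b₀ A (n + (0, 1, 0)) - p1DispSite a h U b₀ A (n + (0, 0, 0))) ^ 2 +
        inner ℝ (hcpSite a h (0, 1, -1)) (p1DispSite a h U b₀ A (n + (0, 1, 0)) - p1DispSite a h U b₀ A (n + (0, 0, 1))) ^ 2 +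
        inner ℝ (hcpSite a h (0, 0, -1)) (p1DispSite a h U b₀ A (n + (1, 1, 0)) - p1DispSite a h U b₀ A (n + (1, 1, 1))) ^ 2 +
        inner ℝ (hcpSite a h (-1, -1, 0)) (p1DispSite a h U b₀ A (n + (0, 0, 1)) - p1DispSite a h U b₀ A (n + (1, 1, 1))) ^ 2 +
        inner ℝ (hcpSite a h (-1, -1, 0)) (p1DispSite a h U b₀ A (n + (0, 0, 0)) - p1DispSite a h U b₀ A (n + (1, 1, 0))) ^ 2 +
        inner ℝ (hcpSite a h (0, 0, 1)) (p1DispSite a h U b₀ A (n + (0, 0, 1)) - p1DispSite a h U b₀ A (n + (0, 0, 0))) ^ 2) := by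
  have hB1 : Even (n + (1, 0, 1)).1 := by
    have hn' : decide (Even n.1) = false := hn
    show Even (n.1 + 1)
    exact (Int.not_even_iff_odd.1 (of_decide_eq_false hn')).add_one
  -- edge vectors from B₁ are hcp-site labels (B₁ lies in an even layer)
  have hd0 : ∀ k, hcpSite a h (n + (0, 0, 0)) k - hcpSite a h (n + (1, 0, 1)) k = hcpSite a h (-1, 0, -1) k := by
    intro k
    have : ((n + (0, 0, 0)) : ℤ × ℤ × ℤ) = (n + (1, 0, 1)) + (-1, 0, -1) := by ext <;> simp
    rw [this, hcpSite_add_of_even a h hB1, PiLp.add_apply]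
    ring
  have hd1 : ∀ k, hcpSite a h (n + (0, 0, 1)) k - hcpSite a h (n + (1, 0, 1)) k = hcpSite a h (-1, 0, 0) k := by
    intro k
    have : ((n + (0, 0, 1)) : ℤ × ℤ × ℤ) = (n + (1, 0, 1)) + (-1, 0, 0) := by ext <;> simp
    rw [this, hcpSite_add_of_even a h hB1, PiLp.add_apply]
    ring
  have hd2 : ∀ k, hcpSite a h (n + (0, 1, 0)) k - hcpSite a h (n + (1, 0, 1)) k = hcpSite a h (-1, 1, -1) k := by
    intro k
    have : ((n + (0, 1, 0)) : ℤ × ℤ × ℤ) = (n + (1, 0, 1)) + (-1, 1, -1) := by ext <;> simp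
    rw [this, hcpSite_add_of_even a h hB1, PiLp.add_apply]
    ring
  have hd3 : ∀ k, hcpSite a h (n + (1, 1, 0)) k - hcpSite a h (n + (1, 0, 1)) k = hcpSite a h (0, 1, -1) k := by
    intro k
    have : ((n + (1, 1, 0)) : ℤ × ℤ × ℤ) = (n + (1, 0, 1)) + (0, 1, -1) := by ext <;> simp
    rw [this, hcpSite_add_of_even a h hB1, PiLp.add_apply]
    ring
  have hd4 : ∀ k, hcpSite a h (n + (1, 1, 1)) k - hcpSite a h (n + (1, 0, 1)) k = hcpSite a h (0, 1, 0) k := by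
    intro k
    have : ((n + (1, 1, 1)) : ℤ × ℤ × ℤ) = (n + (1, 0, 1)) + (0, 1, 0) := by ext <;> simp
    rw [this, hcpSite_add_of_even a h hB1, PiLp.add_apply]
    ring
  have h14 := p1DispSite_vertex_sub ha hh U b₀ A (n, 2) (m := 1) (m' := 0) (v := (n + (0, 1, 0))) (w := (n + (1, 0, 1)))
    (by simp [hn, p1VertOff]) (by simp [hn, p1VertOff]) hd2
  have h11 := p1DispSite_vertex_sub ha hh U b₀ A (n, 2) (m := 2) (m' := 0) (v := (n + (1, 1, 1))) (w := (n + (1, 0, 1)))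
    (by simp [hn, p1VertOff]) (by simp [hn, p1VertOff]) hd4
  have h12 := p1DispSite_vertex_sub ha hh U b₀ A (n, 2) (m := 3) (m' := 0) (v := (n + (1, 1, 0))) (w := (n + (1, 0, 1)))
    (by simp [hn, p1VertOff]) (by simp [hn, p1VertOff]) hd3
  have h24 := p1DispSite_vertex_sub ha hh U b₀ A (n, 3) (m := 1) (m' := 0) (v := (n + (0, 1, 0))) (w := (n + (1, 0, 1)))
    (by simp [hn, p1VertOff]) (by simp [hn, p1VertOff]) hd2
  have h22 := p1DispSite_vertex_sub ha hh U b₀ A (n, 3) (m := 2) (m' := 0) (v := (n + (1, 1, 0))) (w := (n + (1, 0, 1)))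
    (by simp [hn, p1VertOff]) (by simp [hn, p1VertOff]) hd3
  have h23 := p1DispSite_vertex_sub ha hh U b₀ A (n, 3) (m := 3) (m' := 0) (v := (n + (0, 0, 0))) (w := (n + (1, 0, 1)))
    (by simp [hn, p1VertOff]) (by simp [hn, p1VertOff]) hd0
  have h34 := p1DispSite_vertex_sub ha hh U b₀ A (n, 4) (m := 1) (m' := 0) (v := (n + (0, 1, 0))) (w := (n + (1, 0, 1)))
    (by simp [hn, p1VertOff]) (by simp [hn, p1VertOff]) hd2
  have h33 := p1DispSite_vertex_sub ha hh U b₀ A (n, 4) (m := 2) (m' := 0) (v := (n + (0, 0, 0))) (w := (n + (1, 0, 1)))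
    (by simp [hn, p1VertOff]) (by simp [hn, p1VertOff]) hd0
  have h35 := p1DispSite_vertex_sub ha hh U b₀ A (n, 4) (m := 3) (m' := 0) (v := (n + (0, 0, 1))) (w := (n + (1, 0, 1)))
    (by simp [hn, p1VertOff]) (by simp [hn, p1VertOff]) hd1
  have h44 := p1DispSite_vertex_sub ha hh U b₀ A (n, 5) (m := 1) (m' := 0) (v := (n + (0, 1, 0))) (w := (n + (1, 0, 1)))
    (by simp [hn, p1VertOff]) (by simp [hn, p1VertOff]) hd2
  have h45 := p1DispSite_vertex_sub ha hh U b₀ A (n, 5) (m := 2) (m' := 0) (v := (n + (0, 0, 1))) (w := (n + (1, 0, 1)))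
    (by simp [hn, p1VertOff]) (by simp [hn, p1VertOff]) hd1
  have h41 := p1DispSite_vertex_sub ha hh U b₀ A (n, 5) (m := 3) (m' := 0) (v := (n + (1, 1, 1))) (w := (n + (1, 0, 1)))
    (by simp [hn, p1VertOff]) (by simp [hn, p1VertOff]) hd4
  exact hcpOctDown_receipts a h (p1DispSite a h U b₀ A (n + (1, 0, 1))) (p1DispSite a h U b₀ A (n + (1, 1, 1))) (p1DispSite a h U b₀ A (n + (1, 1, 0))) (p1DispSite a h U b₀ A (n + (0, 0, 0))) (p1DispSite a h U b₀ A (n + (0, 1, 0))) (p1DispSite a h U b₀ A (n + (0, 0, 1)))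
    (p1CellGradT a h U A (n, 2)) (p1CellGradT a h U A (n, 3)) (p1CellGradT a h U A (n, 4)) (p1CellGradT a h U A (n, 5)) h14 h11 h12 h24 h22 h23 h34 h33 h35 h44 h45 h41

end Summit.AtomisticToContinuum.Crystallization.Theorems.StrictSplittingRuleBirth
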